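import Summits.QuantumFields.BalabanUV.Beta.GAN24.FineInsertionVolumeLimit

/-!
# `BalabanUV.Beta.GAN24.DiagramVolumeLimitLegs` — binder row G-an2-4 ∕ (CONV-C), route R7 «TWO CURRENCIES», PART 150: LEGS ON THE PAIR LATTICE — THE DRESSED ONE-LOOP DIAGRAM
# `Γ₁(Σ_k ⊗ Σ_k)Γ₂ᴴ` ON `ℤ^d` MODULO ONLY THE LEGS' DECAY AND ENTRY LIMITS.  PART 132 proved (UD)+(SR) for `Γ₁(Σ_k ⊗ₖ Σ_k)Γ₂ᴴ` volume-free for all legs decaying at the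
# cross-distance rate; PART 140's generic END then needs the entry limits of the diagram, whose internal vertices are summed over the PAIR lattice `idx × idx` (two sites + two
# directions per vertex).  §1 is the tool: TANNERY OVER THE PAIR WINDOW (`tendsto_sum_window_pair`, PART 142's `tendsto_sum_window` nested, product majorant); §2–§3 contract the two
# vertices one at a time (`(X ⊗ Y)·Γ₂ᴴ` then `Γ₁·(…)`) for ANY volume-indexed bounded kernels `X_t, Y_t` with pair entry limits and ANY legs with volume-uniform window decay away from
# the root and entry limits at integer triples (EL₃); PART 153 is the END for `Γ₁(Σ_k ⊗ Σ_k)Γ₂ᴴ` — the socket for row an1's LOCAL (or decaying) vertices: whatever the Table-T legs are, two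
# checks (decay at PART 132's rate, EL₃) put the dressed one-loop diagram of the lineage's effective form in the β-cell's `LimitRate` currency on `ℤ^d` (unit b2b-balaban-gan24-p3, gen 55; v1)

NOT IN PRINT; OUR PROOF ([folklore] bookkeeping BY NAME over PART 142 (`tendsto_sum_window`, `l1_windowMap_sub_castT_ge`), PART 146 (`sum_exp_window_le_tsum`), PART 141 (`sum_idx_eq_sum_site`),
the β-cell's window dictionary (`windowMap_injective`, `summable_exp_neg_l1`); [Balaban1987RG1] (1.21)–(1.22) p. 264 LOCATE the shapes; nothing printed is a hypothesis).
HONEST FRAMING (cell contract, verbatim): «discharging `BetaPertH` makes Bałaban's UV stability UNCONDITIONAL — a real constructive-QFT result; it is NOT the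
continuum limit and NOT the Clay problem.»  HONEST DEPENDENCY (verbatim): «continuum YM on T⁴ ⇐ BetaPertH ∧ nine spine estimates (0/9 proved); BetaPertH ⇐
(D1) ∧ (D4) ∧ CAP+tail; G-an2-4 gates asym, D1 and NE2/3/4.»

WHAT THIS FILE PROVES (0 sorry, 0 `def`; `e = (unitIdx L (cubic d s))⁻¹`, `ẑ_t = castT (cubic d (side t)) z`; a LEG is `Γ_t : Matrix idx (idx × idx) ℂ`, its ROOT the row index; «window decay away
from the root» = `‖Γ_t(e(x,μ), (e(u,λ), e(v,λ′)))‖ ≤ γ·e^{−κ|windowMap(u − x)|₁}·e^{−κ|windowMap(v − x)|₁}`; EL₃ = convergence of `Γ_t(e(ẑ,μ), (e(û,λ), e(v̂,λ′)))` at every integer triple):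
* §1 `sum_window_le_tsum`, **`tendsto_sum_window_pair`** — TANNERY OVER THE PAIR WINDOW (product majorant `b₁(windowMap w)·b₂(windowMap w′)`, `b₁, b₂ ≥ 0` summable).
* §2 `exp_neg_mul_l1_windowMap_sub_castT_le` (root shift), `sum_pairIdx_eq`, **`norm_kron_mul_legAdj_le`** (`‖((X ⊗ₖ Y)·Γᴴ)(p, e(y,ν))‖ ≤ B·B·γ·(d·S_κ)²`, volume-free),
  **`tendsto_kron_mul_legAdj_pair`** (EL of `(X_t ⊗ₖ Y_t)·Γ_tᴴ` at integer triples ⇐ `X_t, Y_t` bounded with EL₂, `Γ_t` window-decaying with EL₃).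
* §3 **`tendsto_leg_mul_pair`** (EL₂ of `Γ_t·W_t`, `W_t : Matrix (idx × idx) idx` bounded with EL at integer triples), **`tendsto_legs_pair`** (EL₂ of `Γ₁(X ⊗ₖ Y)Γ₂ᴴ`).
(PART 153 `DiagramVolumeLimitOneLoop` is the END for `Γ₁(Σ_k ⊗ₖ Σ_k)Γ₂ᴴ` over PART 132's (UD)+(SR).)
WHAT IT DOES NOT DO: the END (PART 153); say which legs Bałaban's `Π⁰_{k+1}` has (row an1's Table-T dictionary); level-dependent legs `Γ_{t,k}` (same proofs, follower); legs on the fine lattice; `d ≤ 2` ∕ odd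
volumes.  SUPPLIER work; NEVER «G-an2-4 closed»; NOT (CONV-C), NOT D1, NOT `BetaPertH`, NOT continuum, NOT Clay.  Records: `HOME/b2b-balaban-gan24-p3/gen55/README.md`.
-/

noncomputable section

open scoped BigOperators ComplexConjugate Matrix Matrix.Norms.L2Operator Kronecker
open Filter Topology

namespace Summit.QuantumFields.BalabanUV.Beta.GAN24.DiagramVolumeLimitLegs

open Literature.MathematicalPhysics.QuantumFieldTheory.Balaban1983to89
open Literature.MathematicalPhysics.QuantumFieldTheory.Balaban1983to89.B5Prop11Plancherel (Tor)
open Literature.MathematicalPhysics.QuantumFieldTheory.Balaban1983to89.B12Sec2to5 (l1 summable_exp_neg_l1)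
open Literature.MathematicalPhysics.QuantumFieldTheory.Balaban1983to89.Beta (Site windowMap windowMap_injective)
open Literature.MathematicalPhysics.QuantumFieldTheory.Balaban1983to89.Beta.FreeLegDictionary (cubic)
open Literature.MathematicalPhysics.QuantumFieldTheory.Balaban1983to89.Beta.VectorTails (castT)
open Summit.QuantumFields.BalabanUV.T4Continuum
open Summit.QuantumFields.BalabanUV.T4Continuum.BalabanAveragedTowerUnit (idx)
open Summit.QuantumFields.BalabanUV.T4Continuum.BalabanAveragedCoerciveTower (unitIdx)
open Summit.QuantumFields.BalabanUV.Beta.GAN24.DiagramVolumeLimitAlgebra (sum_idx_eq_sum_site)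
open Summit.QuantumFields.BalabanUV.Beta.GAN24.DiagramVolumeLimitPairs (tendsto_sum_window l1_windowMap_sub_castT_ge)
open Summit.QuantumFields.BalabanUV.Beta.GAN24.FineInsertionVolumeLimit (sum_exp_window_le_tsum)

variable {d : ℕ} (L : ℕ) [NeZero L]

/-! ## §1 Tannery over the pair window -/

section Window

variable {side : ℕ → ℕ} [∀ t, NeZero (side t)]

omit [NeZero L] in
/-- a finite window sum of a nonnegative summable `ℤ^d`-function is at most its series: `Σ_{w ∈ (ℤ∕s)^d} g(windowMap w) ≤ Σ'_y g(y)` (`windowMap` is injective). [folklore] -/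
theorem sum_window_le_tsum (s : ℕ) [NeZero s] {g : (Fin d → ℤ) → ℝ} (hg : Summable g) (hg0 : ∀ y, 0 ≤ g y) :
    ∑ w : Site d s, g (windowMap d s w) ≤ ∑' y, g y := by
  classical
  have e : ∑ w : Site d s, g (windowMap d s w) = ∑ y ∈ Finset.univ.image (windowMap d s), g y := by
    rw [Finset.sum_image fun w _ w' _ h => windowMap_injective d s h]
  rw [e]
  exact hg.sum_le_tsum _ fun y _ => hg0 y

omit [NeZero L] in
/-- **`tendsto_sum_window_pair` — TANNERY OVER THE PAIR WINDOW** [folklore]: along `side t → ∞`, a volume-indexed integrand `F_t(w, w′)` on pairs of torus sites converging at every pair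
of integer readings to `F_∞(y, y′)` and dominated by a PRODUCT majorant `‖F_t(w, w′)‖ ≤ b₁(windowMap w)·b₂(windowMap w′)` with `b₁, b₂ ≥ 0` summable on `ℤ^d` has
`Σ_{w,w′} F_t(w, w′) → Σ'_y Σ'_{y′} F_∞(y, y′)` — PART 142's `tendsto_sum_window` applied to the inner and then to the outer sum. -/
theorem tendsto_sum_window_pair (hside : Tendsto side atTop atTop) {F : (t : ℕ) → Site d (side t) → Site d (side t) → ℂ} {Finf : (Fin d → ℤ) → (Fin d → ℤ) → ℂ}
    (hF : ∀ y y' : Fin d → ℤ, Tendsto (fun t => F t (fun i => (y i : ZMod (side t))) (fun i => (y' i : ZMod (side t)))) atTop (𝓝 (Finf y y')))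
    {b₁ b₂ : (Fin d → ℤ) → ℝ} (hb₁ : Summable b₁) (hb₂ : Summable b₂) (hb₁0 : ∀ y, 0 ≤ b₁ y) (hb₂0 : ∀ y, 0 ≤ b₂ y)
    (hbd : ∀ t (w w' : Site d (side t)), ‖F t w w'‖ ≤ b₁ (windowMap d (side t) w) * b₂ (windowMap d (side t) w')) :
    Tendsto (fun t => ∑ w, ∑ w', F t w w') atTop (𝓝 (∑' y, ∑' y', Finf y y')) := by
  have hinner : ∀ y : Fin d → ℤ, Tendsto (fun t => ∑ w', F t (fun i => (y i : ZMod (side t))) w') atTop (𝓝 (∑' y', Finf y y')) := by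
    intro y
    refine tendsto_sum_window hside (F := fun t w' => F t (fun i => (y i : ZMod (side t))) w') (hF y) (hb₂.mul_left (∑' x, b₁ x))
      (fun y' => mul_nonneg (tsum_nonneg hb₁0) (hb₂0 y')) fun t w' => ?_
    exact (hbd t _ w').trans (mul_le_mul_of_nonneg_right (hb₁.le_tsum _ fun j _ => hb₁0 j) (hb₂0 _))
  refine tendsto_sum_window hside (F := fun t w => ∑ w', F t w w') hinner (hb₁.mul_right (∑' x, b₂ x)) (fun y => mul_nonneg (hb₁0 y) (tsum_nonneg hb₂0)) fun t w => ?_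
  calc ‖∑ w', F t w w'‖ ≤ ∑ w', ‖F t w w'‖ := norm_sum_le _ _
    _ ≤ ∑ w', b₁ (windowMap d (side t) w) * b₂ (windowMap d (side t) w') := Finset.sum_le_sum fun w' _ => hbd t w w'
    _ = b₁ (windowMap d (side t) w) * ∑ w', b₂ (windowMap d (side t) w') := by rw [Finset.mul_sum]
    _ ≤ b₁ (windowMap d (side t) w) * ∑' x, b₂ x := mul_le_mul_of_nonneg_left (sum_window_le_tsum (side t) hb₂ hb₂0) (hb₁0 _)

end Window

/-! ## §2 The right vertex: `(X ⊗ₖ Y)·Γᴴ` -/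

section Legs

variable {side : ℕ → ℕ} [∀ t, NeZero (side t)]

omit [NeZero L] in
/-- the ROOT SHIFT: `e^{−κ|windowMap(w − ẑ)|₁} ≤ e^{3κ|z|₁}·e^{−κ|windowMap w|₁}` (`κ ≥ 0`; PART 142's `l1_windowMap_sub_castT_ge`). [folklore] -/
theorem exp_neg_mul_l1_windowMap_sub_castT_le (s : ℕ) [NeZero s] {κ : ℝ} (hκ : 0 ≤ κ) (w : Site d s) (z : Fin d → ℤ) :
    Real.exp (-κ * l1 (windowMap d s (w - castT (cubic d s) z))) ≤ Real.exp (3 * κ * l1 z) * Real.exp (-κ * l1 (windowMap d s w)) := by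
  rw [← Real.exp_add]
  have h := l1_windowMap_sub_castT_ge s w z
  exact Real.exp_le_exp.mpr (by nlinarith)

/-- a sum over the pair lattice `idx × idx` is the nested sum over two directions and two sites. [folklore] -/
theorem sum_pairIdx_eq (s : ℕ) [NeZero s] (f : idx L (cubic d s) 0 × idx L (cubic d s) 0 → ℂ) :
    ∑ q, f q = ∑ l₁ : Fin d, ∑ w₁ : Site d s, ∑ w₂ : Site d s, ∑ l₂ : Fin d, f ((unitIdx L (cubic d s)).symm (w₁, l₁), (unitIdx L (cubic d s)).symm (w₂, l₂)) := by
  rw [Fintype.sum_prod_type]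
  simp only [sum_idx_eq_sum_site]
  exact Finset.sum_congr rfl fun l₁ _ => Finset.sum_congr rfl fun w₁ _ => Finset.sum_comm

/-- **`norm_kron_mul_legAdj_le` — THE RIGHT VERTEX IS BOUNDED, VOLUME-FREE** [folklore]: `‖X(i,j)‖, ‖Y(i,j)‖ ≤ B` and a leg with window decay away from its root
(`‖Γ(e(x,μ),(e(u,λ),e(v,λ′)))‖ ≤ γ·e^{−κ|windowMap(u − x)|₁}·e^{−κ|windowMap(v − x)|₁}`, `κ > 0`) give `‖((X ⊗ₖ Y)·Γᴴ)(p, e(y,ν))‖ ≤ B·B·γ·(d·S_κ)²`, `S_κ = Σ'_y e^{−κ|y|₁}`. -/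
theorem norm_kron_mul_legAdj_le (s : ℕ) [NeZero s] {X Y : Matrix (idx L (cubic d s) 0) (idx L (cubic d s) 0) ℂ}
    {Γ : Matrix (idx L (cubic d s) 0) (idx L (cubic d s) 0 × idx L (cubic d s) 0) ℂ} {B γ κ : ℝ} (hB : 0 ≤ B)
    (hXb : ∀ i j, ‖X i j‖ ≤ B) (hYb : ∀ i j, ‖Y i j‖ ≤ B)
    (hΓ : ∀ (x : Site d s) (μ : Fin d) (u : Site d s) (l : Fin d) (v : Site d s) (l' : Fin d),
      ‖Γ ((unitIdx L (cubic d s)).symm (x, μ)) ((unitIdx L (cubic d s)).symm (u, l), (unitIdx L (cubic d s)).symm (v, l'))‖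
        ≤ γ * (Real.exp (-κ * l1 (windowMap d s (u - x))) * Real.exp (-κ * l1 (windowMap d s (v - x))))) (hκ : 0 < κ)
    (p : idx L (cubic d s) 0 × idx L (cubic d s) 0) (y : Site d s) (ν : Fin d) :
    ‖((X ⊗ₖ Y) * Γᴴ) p ((unitIdx L (cubic d s)).symm (y, ν))‖ ≤ B * B * γ * (d * ∑' x : Fin d → ℤ, Real.exp (-κ * l1 x)) ^ 2 := by
  have hγ : 0 ≤ γ := by
    have h := hΓ y ν y ν y ν
    exact nonneg_of_mul_nonneg_left ((norm_nonneg _).trans h) (by positivity)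
  set S : ℝ := ∑' x : Fin d → ℤ, Real.exp (-κ * l1 x) with hS
  have hSw : ∀ x : Site d s, ∑ w : Site d s, Real.exp (-κ * l1 (windowMap d s (w - x))) ≤ S := fun x => sum_exp_window_le_tsum s hκ x
  rw [Matrix.mul_apply, sum_pairIdx_eq]
  calc ‖∑ l₁ : Fin d, ∑ w₁ : Site d s, ∑ w₂ : Site d s, ∑ l₂ : Fin d,
          (X ⊗ₖ Y) p ((unitIdx L (cubic d s)).symm (w₁, l₁), (unitIdx L (cubic d s)).symm (w₂, l₂))
            * Γᴴ ((unitIdx L (cubic d s)).symm (w₁, l₁), (unitIdx L (cubic d s)).symm (w₂, l₂)) ((unitIdx L (cubic d s)).symm (y, ν))‖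
      ≤ ∑ _l₁ : Fin d, ∑ w₁ : Site d s, ∑ w₂ : Site d s, ∑ _l₂ : Fin d,
          B * B * γ * (Real.exp (-κ * l1 (windowMap d s (w₁ - y))) * Real.exp (-κ * l1 (windowMap d s (w₂ - y)))) := by
        refine norm_sum_le_of_le _ fun l₁ _ => norm_sum_le_of_le _ fun w₁ _ => norm_sum_le_of_le _ fun w₂ _ =>
          norm_sum_le_of_le _ fun l₂ _ => ?_
        rw [norm_mul, Matrix.kroneckerMap_apply, norm_mul, Matrix.conjTranspose_apply, norm_star]
        have h1 := hXb p.1 ((unitIdx L (cubic d s)).symm (w₁, l₁))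
        have h2 := hYb p.2 ((unitIdx L (cubic d s)).symm (w₂, l₂))
        have h3 := hΓ y ν w₁ l₁ w₂ l₂
        calc ‖X p.1 _‖ * ‖Y p.2 _‖ * ‖Γ _ _‖ ≤ B * B * (γ * (Real.exp (-κ * l1 (windowMap d s (w₁ - y))) * Real.exp (-κ * l1 (windowMap d s (w₂ - y))))) :=
              mul_le_mul (mul_le_mul h1 h2 (norm_nonneg _) hB) h3 (norm_nonneg _) (mul_nonneg hB hB)
          _ = _ := by ring
    _ = d * (B * B * γ * ((∑ w₁ : Site d s, Real.exp (-κ * l1 (windowMap d s (w₁ - y)))) * (d * ∑ w₂ : Site d s, Real.exp (-κ * l1 (windowMap d s (w₂ - y)))))) := by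
        simp only [Finset.sum_const, Finset.card_univ, Fintype.card_fin, nsmul_eq_mul, Finset.mul_sum, Finset.sum_mul]
        refine Finset.sum_congr rfl fun w₁ _ => Finset.sum_congr rfl fun w₂ _ => by ring
    _ ≤ d * (B * B * γ * (S * (d * S))) := by
        have hd0 : (0 : ℝ) ≤ d := Nat.cast_nonneg _
        have hS0 : 0 ≤ S := tsum_nonneg fun x => (Real.exp_pos _).le
        have hs1 := hSw y
        have hs0 : 0 ≤ ∑ w₂ : Site d s, Real.exp (-κ * l1 (windowMap d s (w₂ - y))) := Finset.sum_nonneg fun _ _ => (Real.exp_pos _).le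
        gcongr
    _ = B * B * γ * (d * S) ^ 2 := by ring

/-- **`tendsto_kron_mul_legAdj_pair` — EL OF THE RIGHT VERTEX AT INTEGER TRIPLES** [folklore]: along `side t → ∞`: `X_t, Y_t` volume-uniformly bounded with EL₂, a leg `Γ_t` with
volume-uniform window decay away from its root (`κ > 0`) and EL₃ ⟹ `((X_t ⊗ₖ Y_t)·Γ_tᴴ)((e(û,λ),e(v̂,λ′)), e(ẑ′,ν))` converges for all `λ, λ′, ν, u, v, z′` — §1's pair Tannery with the
product majorant `d·B²γ·e^{6κ|z′|₁}·e^{−κ|y₁|₁}·e^{−κ|y₂|₁}` (root shift). -/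
theorem tendsto_kron_mul_legAdj_pair (hside : Tendsto side atTop atTop)
    {X Y : (t : ℕ) → Matrix (idx L (cubic d (side t)) 0) (idx L (cubic d (side t)) 0) ℂ}
    {Γ : (t : ℕ) → Matrix (idx L (cubic d (side t)) 0) (idx L (cubic d (side t)) 0 × idx L (cubic d (side t)) 0) ℂ} {B γ κ : ℝ} (hB : 0 ≤ B)
    (hXb : ∀ t i j, ‖X t i j‖ ≤ B) (hYb : ∀ t i j, ‖Y t i j‖ ≤ B)
    (hΓ : ∀ t (x : Site d (side t)) (μ : Fin d) (u : Site d (side t)) (l : Fin d) (v : Site d (side t)) (l' : Fin d),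
      ‖Γ t ((unitIdx L (cubic d (side t))).symm (x, μ)) ((unitIdx L (cubic d (side t))).symm (u, l), (unitIdx L (cubic d (side t))).symm (v, l'))‖
        ≤ γ * (Real.exp (-κ * l1 (windowMap d (side t) (u - x))) * Real.exp (-κ * l1 (windowMap d (side t) (v - x))))) (hκ : 0 < κ)
    (hXel : ∀ (μ ν : Fin d) (z z' : Fin d → ℤ), ∃ s' : ℂ, Tendsto (fun t => X t ((unitIdx L (cubic d (side t))).symm (castT (cubic d (side t)) z, μ))
      ((unitIdx L (cubic d (side t))).symm (castT (cubic d (side t)) z', ν))) atTop (𝓝 s'))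
    (hYel : ∀ (μ ν : Fin d) (z z' : Fin d → ℤ), ∃ s' : ℂ, Tendsto (fun t => Y t ((unitIdx L (cubic d (side t))).symm (castT (cubic d (side t)) z, μ))
      ((unitIdx L (cubic d (side t))).symm (castT (cubic d (side t)) z', ν))) atTop (𝓝 s'))
    (hΓel : ∀ (μ l l' : Fin d) (z u v : Fin d → ℤ), ∃ s' : ℂ, Tendsto (fun t => Γ t ((unitIdx L (cubic d (side t))).symm (castT (cubic d (side t)) z, μ))
      ((unitIdx L (cubic d (side t))).symm (castT (cubic d (side t)) u, l), (unitIdx L (cubic d (side t))).symm (castT (cubic d (side t)) v, l'))) atTop (𝓝 s'))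
    (l l' ν : Fin d) (u v z' : Fin d → ℤ) :
    ∃ s' : ℂ, Tendsto (fun t => ((X t ⊗ₖ Y t) * (Γ t)ᴴ)
        ((unitIdx L (cubic d (side t))).symm (castT (cubic d (side t)) u, l), (unitIdx L (cubic d (side t))).symm (castT (cubic d (side t)) v, l'))
        ((unitIdx L (cubic d (side t))).symm (castT (cubic d (side t)) z', ν))) atTop (𝓝 s') := by
  choose P hP using hXel
  choose Q hQ using hYel
  choose R hR using hΓel
  have hγ : 0 ≤ γ := by
    have h := hΓ 0 0 ν 0 ν 0 ν
    exact nonneg_of_mul_nonneg_left ((norm_nonneg _).trans h) (by positivity)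
  refine ⟨∑ l₁, ∑' y₁, ∑' y₂, ∑ l₂, P l l₁ u y₁ * Q l' l₂ v y₂ * star (R ν l₁ l₂ z' y₁ y₂), ?_⟩
  have e : ∀ t, ((X t ⊗ₖ Y t) * (Γ t)ᴴ)
        ((unitIdx L (cubic d (side t))).symm (castT (cubic d (side t)) u, l), (unitIdx L (cubic d (side t))).symm (castT (cubic d (side t)) v, l'))
        ((unitIdx L (cubic d (side t))).symm (castT (cubic d (side t)) z', ν))
      = ∑ l₁ : Fin d, ∑ w₁ : Site d (side t), ∑ w₂ : Site d (side t), ∑ l₂ : Fin d,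
          X t ((unitIdx L (cubic d (side t))).symm (castT (cubic d (side t)) u, l)) ((unitIdx L (cubic d (side t))).symm (w₁, l₁))
            * Y t ((unitIdx L (cubic d (side t))).symm (castT (cubic d (side t)) v, l')) ((unitIdx L (cubic d (side t))).symm (w₂, l₂))
            * star (Γ t ((unitIdx L (cubic d (side t))).symm (castT (cubic d (side t)) z', ν))
              ((unitIdx L (cubic d (side t))).symm (w₁, l₁), (unitIdx L (cubic d (side t))).symm (w₂, l₂))) := by
    intro t
    rw [Matrix.mul_apply, sum_pairIdx_eq]
    simp only [Matrix.kroneckerMap_apply, Matrix.conjTranspose_apply]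
  simp only [e]
  refine tendsto_finsetSum _ fun l₁ _ => ?_
  refine tendsto_sum_window_pair hside
    (F := fun t w₁ w₂ => ∑ l₂ : Fin d,
      X t ((unitIdx L (cubic d (side t))).symm (castT (cubic d (side t)) u, l)) ((unitIdx L (cubic d (side t))).symm (w₁, l₁))
        * Y t ((unitIdx L (cubic d (side t))).symm (castT (cubic d (side t)) v, l')) ((unitIdx L (cubic d (side t))).symm (w₂, l₂))
        * star (Γ t ((unitIdx L (cubic d (side t))).symm (castT (cubic d (side t)) z', ν))
          ((unitIdx L (cubic d (side t))).symm (w₁, l₁), (unitIdx L (cubic d (side t))).symm (w₂, l₂))))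
    (fun y₁ y₂ => tendsto_finsetSum _ fun l₂ _ => ((hP l l₁ u y₁).mul (hQ l' l₂ v y₂)).mul (hR ν l₁ l₂ z' y₁ y₂).star)
    (b₁ := fun y => d * (B * B * γ) * Real.exp (3 * κ * l1 z') * Real.exp (-κ * l1 y)) (b₂ := fun y => Real.exp (3 * κ * l1 z') * Real.exp (-κ * l1 y))
    ((summable_exp_neg_l1 hκ d).mul_left _) ((summable_exp_neg_l1 hκ d).mul_left _) (fun y => by positivity) (fun y => by positivity) fun t w₁ w₂ => ?_
  calc ‖∑ l₂ : Fin d, X t _ _ * Y t _ _ * star (Γ t _ _)‖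
      ≤ ∑ _l₂ : Fin d, B * B * γ * ((Real.exp (3 * κ * l1 z') * Real.exp (-κ * l1 (windowMap d (side t) w₁))) * (Real.exp (3 * κ * l1 z') * Real.exp (-κ * l1 (windowMap d (side t) w₂)))) := by
        refine norm_sum_le_of_le _ fun l₂ _ => ?_
        rw [norm_mul, norm_mul, norm_star]
        have h1 := hXb t ((unitIdx L (cubic d (side t))).symm (castT (cubic d (side t)) u, l)) ((unitIdx L (cubic d (side t))).symm (w₁, l₁))
        have h2 := hYb t ((unitIdx L (cubic d (side t))).symm (castT (cubic d (side t)) v, l')) ((unitIdx L (cubic d (side t))).symm (w₂, l₂))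
        have h3 := hΓ t (castT (cubic d (side t)) z') ν w₁ l₁ w₂ l₂
        have h4 := exp_neg_mul_l1_windowMap_sub_castT_le (side t) hκ.le w₁ z'
        have h5 := exp_neg_mul_l1_windowMap_sub_castT_le (side t) hκ.le w₂ z'
        calc ‖X t _ _‖ * ‖Y t _ _‖ * ‖Γ t _ _‖
            ≤ B * B * (γ * (Real.exp (-κ * l1 (windowMap d (side t) (w₁ - castT (cubic d (side t)) z'))) * Real.exp (-κ * l1 (windowMap d (side t) (w₂ - castT (cubic d (side t)) z'))))) :=
              mul_le_mul (mul_le_mul h1 h2 (norm_nonneg _) hB) h3 (norm_nonneg _) (mul_nonneg hB hB)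
          _ ≤ B * B * (γ * ((Real.exp (3 * κ * l1 z') * Real.exp (-κ * l1 (windowMap d (side t) w₁))) * (Real.exp (3 * κ * l1 z') * Real.exp (-κ * l1 (windowMap d (side t) w₂))))) := by
              gcongr
          _ = _ := by ring
    _ = (d * (B * B * γ) * Real.exp (3 * κ * l1 z') * Real.exp (-κ * l1 (windowMap d (side t) w₁))) * (Real.exp (3 * κ * l1 z') * Real.exp (-κ * l1 (windowMap d (side t) w₂))) := by
        rw [Finset.sum_const, Finset.card_univ, Fintype.card_fin, nsmul_eq_mul]; ring

/-! ## §3 The left vertex: `Γ·W`, and both legs -/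

/-- **`tendsto_leg_mul_pair` — EL₂ OF THE LEFT VERTEX** [folklore]: along `side t → ∞`: `W_t : Matrix (idx × idx) idx` volume-uniformly bounded (`‖W_t(p, j)‖ ≤ B_W`) with entry limits at
integer triples, a leg `Γ_t` with volume-uniform window decay away from its root (`κ > 0`) and EL₃ ⟹ `(Γ_t·W_t)(e(ẑ,μ), e(ẑ′,ν))` converges — §1's pair Tannery, root shift by `ẑ`. -/
theorem tendsto_leg_mul_pair (hside : Tendsto side atTop atTop)
    {Γ : (t : ℕ) → Matrix (idx L (cubic d (side t)) 0) (idx L (cubic d (side t)) 0 × idx L (cubic d (side t)) 0) ℂ}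
    {W : (t : ℕ) → Matrix (idx L (cubic d (side t)) 0 × idx L (cubic d (side t)) 0) (idx L (cubic d (side t)) 0) ℂ} {BW γ κ : ℝ}
    (hΓ : ∀ t (x : Site d (side t)) (μ : Fin d) (u : Site d (side t)) (l : Fin d) (v : Site d (side t)) (l' : Fin d),
      ‖Γ t ((unitIdx L (cubic d (side t))).symm (x, μ)) ((unitIdx L (cubic d (side t))).symm (u, l), (unitIdx L (cubic d (side t))).symm (v, l'))‖
        ≤ γ * (Real.exp (-κ * l1 (windowMap d (side t) (u - x))) * Real.exp (-κ * l1 (windowMap d (side t) (v - x))))) (hκ : 0 < κ)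
    (hWb : ∀ t p j, ‖W t p j‖ ≤ BW)
    (hΓel : ∀ (μ l l' : Fin d) (z u v : Fin d → ℤ), ∃ s' : ℂ, Tendsto (fun t => Γ t ((unitIdx L (cubic d (side t))).symm (castT (cubic d (side t)) z, μ))
      ((unitIdx L (cubic d (side t))).symm (castT (cubic d (side t)) u, l), (unitIdx L (cubic d (side t))).symm (castT (cubic d (side t)) v, l'))) atTop (𝓝 s'))
    (hWel : ∀ (l l' ν : Fin d) (u v z' : Fin d → ℤ), ∃ s' : ℂ, Tendsto (fun t => W t
      ((unitIdx L (cubic d (side t))).symm (castT (cubic d (side t)) u, l), (unitIdx L (cubic d (side t))).symm (castT (cubic d (side t)) v, l'))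
      ((unitIdx L (cubic d (side t))).symm (castT (cubic d (side t)) z', ν))) atTop (𝓝 s'))
    (μ ν : Fin d) (z z' : Fin d → ℤ) :
    ∃ s' : ℂ, Tendsto (fun t => (Γ t * W t) ((unitIdx L (cubic d (side t))).symm (castT (cubic d (side t)) z, μ)) ((unitIdx L (cubic d (side t))).symm (castT (cubic d (side t)) z', ν)))
      atTop (𝓝 s') := by
  choose R hR using hΓel
  choose S hS using hWel
  have hγ : 0 ≤ γ := by
    have h := hΓ 0 0 ν 0 ν 0 ν
    exact nonneg_of_mul_nonneg_left ((norm_nonneg _).trans h) (by positivity)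
  have hBW : 0 ≤ BW := (norm_nonneg _).trans (hWb 0 ((unitIdx L (cubic d (side 0))).symm (0, ν), (unitIdx L (cubic d (side 0))).symm (0, ν)) ((unitIdx L (cubic d (side 0))).symm (0, ν)))
  refine ⟨∑ l₁, ∑' y₁, ∑' y₂, ∑ l₂, R μ l₁ l₂ z y₁ y₂ * S l₁ l₂ ν y₁ y₂ z', ?_⟩
  have e : ∀ t, (Γ t * W t) ((unitIdx L (cubic d (side t))).symm (castT (cubic d (side t)) z, μ)) ((unitIdx L (cubic d (side t))).symm (castT (cubic d (side t)) z', ν))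
      = ∑ l₁ : Fin d, ∑ w₁ : Site d (side t), ∑ w₂ : Site d (side t), ∑ l₂ : Fin d,
          Γ t ((unitIdx L (cubic d (side t))).symm (castT (cubic d (side t)) z, μ)) ((unitIdx L (cubic d (side t))).symm (w₁, l₁), (unitIdx L (cubic d (side t))).symm (w₂, l₂))
            * W t ((unitIdx L (cubic d (side t))).symm (w₁, l₁), (unitIdx L (cubic d (side t))).symm (w₂, l₂)) ((unitIdx L (cubic d (side t))).symm (castT (cubic d (side t)) z', ν)) := by
    intro t
    rw [Matrix.mul_apply, sum_pairIdx_eq]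
  simp only [e]
  refine tendsto_finsetSum _ fun l₁ _ => ?_
  refine tendsto_sum_window_pair hside
    (F := fun t w₁ w₂ => ∑ l₂ : Fin d,
      Γ t ((unitIdx L (cubic d (side t))).symm (castT (cubic d (side t)) z, μ)) ((unitIdx L (cubic d (side t))).symm (w₁, l₁), (unitIdx L (cubic d (side t))).symm (w₂, l₂))
        * W t ((unitIdx L (cubic d (side t))).symm (w₁, l₁), (unitIdx L (cubic d (side t))).symm (w₂, l₂)) ((unitIdx L (cubic d (side t))).symm (castT (cubic d (side t)) z', ν)))
    (fun y₁ y₂ => tendsto_finsetSum _ fun l₂ _ => (hR μ l₁ l₂ z y₁ y₂).mul (hS l₁ l₂ ν y₁ y₂ z'))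
    (b₁ := fun y => d * (γ * BW) * Real.exp (3 * κ * l1 z) * Real.exp (-κ * l1 y)) (b₂ := fun y => Real.exp (3 * κ * l1 z) * Real.exp (-κ * l1 y))
    ((summable_exp_neg_l1 hκ d).mul_left _) ((summable_exp_neg_l1 hκ d).mul_left _) (fun y => by positivity) (fun y => by positivity) fun t w₁ w₂ => ?_
  calc ‖∑ l₂ : Fin d, Γ t _ _ * W t _ _‖
      ≤ ∑ _l₂ : Fin d, γ * BW * ((Real.exp (3 * κ * l1 z) * Real.exp (-κ * l1 (windowMap d (side t) w₁))) * (Real.exp (3 * κ * l1 z) * Real.exp (-κ * l1 (windowMap d (side t) w₂)))) := by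
        refine norm_sum_le_of_le _ fun l₂ _ => ?_
        rw [norm_mul]
        have h3 := hΓ t (castT (cubic d (side t)) z) μ w₁ l₁ w₂ l₂
        have h2 := hWb t ((unitIdx L (cubic d (side t))).symm (w₁, l₁), (unitIdx L (cubic d (side t))).symm (w₂, l₂)) ((unitIdx L (cubic d (side t))).symm (castT (cubic d (side t)) z', ν))
        have h4 := exp_neg_mul_l1_windowMap_sub_castT_le (side t) hκ.le w₁ z
        have h5 := exp_neg_mul_l1_windowMap_sub_castT_le (side t) hκ.le w₂ z
        calc ‖Γ t _ _‖ * ‖W t _ _‖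
            ≤ (γ * (Real.exp (-κ * l1 (windowMap d (side t) (w₁ - castT (cubic d (side t)) z))) * Real.exp (-κ * l1 (windowMap d (side t) (w₂ - castT (cubic d (side t)) z))))) * BW :=
              mul_le_mul h3 h2 (norm_nonneg _) (by positivity)
          _ ≤ (γ * ((Real.exp (3 * κ * l1 z) * Real.exp (-κ * l1 (windowMap d (side t) w₁))) * (Real.exp (3 * κ * l1 z) * Real.exp (-κ * l1 (windowMap d (side t) w₂))))) * BW := by
              gcongr
          _ = _ := by ring
    _ = (d * (γ * BW) * Real.exp (3 * κ * l1 z) * Real.exp (-κ * l1 (windowMap d (side t) w₁))) * (Real.exp (3 * κ * l1 z) * Real.exp (-κ * l1 (windowMap d (side t) w₂))) := by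
        rw [Finset.sum_const, Finset.card_univ, Fintype.card_fin, nsmul_eq_mul]; ring

/-- **`tendsto_legs_pair` — EL₂ OF THE DRESSED DIAGRAM `Γ₁(X ⊗ₖ Y)Γ₂ᴴ`** [folklore]: along `side t → ∞`: `X_t, Y_t` volume-uniformly bounded (`B ≥ 0`) with EL₂; legs `Γ₁_t, Γ₂_t` with
volume-uniform window decay away from their roots (`κ > 0`) and EL₃ ⟹ the entries of `Γ₁_t·(X_t ⊗ₖ Y_t)·Γ₂_tᴴ` converge at every pair of integer readings (§2 for the right vertex and
its volume-free bound, then §3 for the left vertex). -/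
theorem tendsto_legs_pair (hside : Tendsto side atTop atTop)
    {X Y : (t : ℕ) → Matrix (idx L (cubic d (side t)) 0) (idx L (cubic d (side t)) 0) ℂ}
    {Γ₁ Γ₂ : (t : ℕ) → Matrix (idx L (cubic d (side t)) 0) (idx L (cubic d (side t)) 0 × idx L (cubic d (side t)) 0) ℂ} {B γ₁ γ₂ κ : ℝ} (hB : 0 ≤ B)
    (hXb : ∀ t i j, ‖X t i j‖ ≤ B) (hYb : ∀ t i j, ‖Y t i j‖ ≤ B)
    (hΓ₁ : ∀ t (x : Site d (side t)) (μ : Fin d) (u : Site d (side t)) (l : Fin d) (v : Site d (side t)) (l' : Fin d),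
      ‖Γ₁ t ((unitIdx L (cubic d (side t))).symm (x, μ)) ((unitIdx L (cubic d (side t))).symm (u, l), (unitIdx L (cubic d (side t))).symm (v, l'))‖
        ≤ γ₁ * (Real.exp (-κ * l1 (windowMap d (side t) (u - x))) * Real.exp (-κ * l1 (windowMap d (side t) (v - x)))))
    (hΓ₂ : ∀ t (x : Site d (side t)) (μ : Fin d) (u : Site d (side t)) (l : Fin d) (v : Site d (side t)) (l' : Fin d),
      ‖Γ₂ t ((unitIdx L (cubic d (side t))).symm (x, μ)) ((unitIdx L (cubic d (side t))).symm (u, l), (unitIdx L (cubic d (side t))).symm (v, l'))‖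
        ≤ γ₂ * (Real.exp (-κ * l1 (windowMap d (side t) (u - x))) * Real.exp (-κ * l1 (windowMap d (side t) (v - x))))) (hκ : 0 < κ)
    (hXel : ∀ (μ ν : Fin d) (z z' : Fin d → ℤ), ∃ s' : ℂ, Tendsto (fun t => X t ((unitIdx L (cubic d (side t))).symm (castT (cubic d (side t)) z, μ))
      ((unitIdx L (cubic d (side t))).symm (castT (cubic d (side t)) z', ν))) atTop (𝓝 s'))
    (hYel : ∀ (μ ν : Fin d) (z z' : Fin d → ℤ), ∃ s' : ℂ, Tendsto (fun t => Y t ((unitIdx L (cubic d (side t))).symm (castT (cubic d (side t)) z, μ))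
      ((unitIdx L (cubic d (side t))).symm (castT (cubic d (side t)) z', ν))) atTop (𝓝 s'))
    (hΓ₁el : ∀ (μ l l' : Fin d) (z u v : Fin d → ℤ), ∃ s' : ℂ, Tendsto (fun t => Γ₁ t ((unitIdx L (cubic d (side t))).symm (castT (cubic d (side t)) z, μ))
      ((unitIdx L (cubic d (side t))).symm (castT (cubic d (side t)) u, l), (unitIdx L (cubic d (side t))).symm (castT (cubic d (side t)) v, l'))) atTop (𝓝 s'))
    (hΓ₂el : ∀ (μ l l' : Fin d) (z u v : Fin d → ℤ), ∃ s' : ℂ, Tendsto (fun t => Γ₂ t ((unitIdx L (cubic d (side t))).symm (castT (cubic d (side t)) z, μ))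
      ((unitIdx L (cubic d (side t))).symm (castT (cubic d (side t)) u, l), (unitIdx L (cubic d (side t))).symm (castT (cubic d (side t)) v, l'))) atTop (𝓝 s'))
    (μ ν : Fin d) (z z' : Fin d → ℤ) :
    ∃ s' : ℂ, Tendsto (fun t => (Γ₁ t * (X t ⊗ₖ Y t) * (Γ₂ t)ᴴ) ((unitIdx L (cubic d (side t))).symm (castT (cubic d (side t)) z, μ))
      ((unitIdx L (cubic d (side t))).symm (castT (cubic d (side t)) z', ν))) atTop (𝓝 s') := by
  have hd0 : (0 : ℝ) ≤ d := Nat.cast_nonneg _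
  have hγ₂ : 0 ≤ γ₂ := by
    have h := hΓ₂ 0 0 ν 0 ν 0 ν
    exact nonneg_of_mul_nonneg_left ((norm_nonneg _).trans h) (by positivity)
  obtain ⟨s', hs'⟩ := tendsto_leg_mul_pair L hside (W := fun t => (X t ⊗ₖ Y t) * (Γ₂ t)ᴴ) hΓ₁ hκ
    (BW := B * B * γ₂ * (d * ∑' x : Fin d → ℤ, Real.exp (-κ * l1 x)) ^ 2)
    (fun t p j => by
      obtain ⟨⟨y, ν'⟩, hy⟩ := (unitIdx L (cubic d (side t))).symm.surjective j
      rw [← hy]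
      exact norm_kron_mul_legAdj_le L (side t) hB (hXb t) (hYb t) (hΓ₂ t) hκ p y ν')
    hΓ₁el (fun l l' ν' u v w => tendsto_kron_mul_legAdj_pair L hside hB hXb hYb hΓ₂ hκ hXel hYel hΓ₂el l l' ν' u v w) μ ν z z'
  refine ⟨s', hs'.congr fun t => ?_⟩
  rw [Matrix.mul_assoc]

end Legs

end Summit.QuantumFields.BalabanUV.Beta.GAN24.DiagramVolumeLimitLegs

end
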